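import Literature.Barriers.AtomisticToContinuum.OneDimensionalHardCorePositivity
import Mathlib.Analysis.Fourier.AddCircle
import HarnessLib

/-!
# The Girardeau gas: the momentum sum rule `∑ₘ c_m(N) = N` (Parseval)

`Literature/Barriers/AtomisticToContinuum` (D-0021 barrier catalogue, conjunct
`BoseEinsteinCondensation`). Companion of `OneDimensionalHardCore.lean` (statement file),
`OneDimensionalHardCoreBands.lean` (plane-wave occupations `momentumOccupation N L m = c_m(N)` and
bands `bandOccupation N L M = B_M(N) = ∑_{|m| ≤ M} c_m(N)`, `|B_M(N)| ≤ 8e√N√(2M+1)`) and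
`OneDimensionalHardCorePositivity.lean` (Gram form of `⟨φ, γ_N φ⟩`, `0 ≤ c_m(N) ≤ c₀(N)`,
`c₀(N) ≤ B_M(N)`; twelfth barrier audit).

This file (twelfth barrier audit, 2026-08-16) types the momentum-space trace of the one-body
density matrix, printed as `∑_{n=-∞}^{∞} c_n(N) = N` [ForresterEtAl2003, §2.2.1] and listed as
outstanding in the catalogue entry (caveat (q)(4): "the momentum-space trace `∑_m c_m(N) = N`
(Parseval on `[0, L]`)"):

* `hasSum_sq_norm_integral_girardeauState_ez`: Parseval on `[0, L]` for the smeared state,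
  `∑_{m ∈ ℤ} |∫₀ᴸ ψ_{n+1}(X, y) e_m(y) dy|² = L ∫₀ᴸ ψ_{n+1}(X, y)² dy` at every `X ∈ ℝⁿ`
  (Mathlib's `hasSum_sq_fourierCoeffOn` on `AddCircle L`; the state is bounded and continuous);
* `integral_integral_girardeauState_snoc_sq`: the normalisation `∫_{[0,L]^n}∫₀ᴸ ψ_{n+1}² = 1`, read
  off the typed diagonal `ρ_N(a, a) = N/L` (`girardeauDensityMatrix_self`) by one Fubini swap;
* `hasSum_momentumOccupation`: **`∑_{m ∈ ℤ} c_m(N) = N`** (unconditional sum over `ℤ`) for every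
  `N` and every `L > 0` — the Gram form `c_m = L⁻¹N∫|∫ψ_N e_m|²dX` of the Positivity companion,
  Parseval at each `X`, and summation under the `X`-integral for non-negative terms (bounded partial
  sums, `hasSum_integral_of_summable_integral_norm`); `tsum_momentumOccupation`,
  `summable_momentumOccupation`;
* consequences for bands: `B_M(N) ≤ N` for all `M` (`bandOccupation_le`) and `B_M(N) → N` as
  `M → ∞` at fixed `N` (`tendsto_bandOccupation_atTop`), completing the typed picture
  `0 ≤ c_m ≤ c₀ ≤ 4e√N`, `c₀ ≤ B_M ≤ min(N, 8e√N√(2M+1))`, `B_M ↑ N`.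

With this file every structural statement about the momentum distribution of Girardeau's gas that
the catalogue entry quotes from [ForresterEtAl2003, §2.2.1] is a theorem of the tree; printed-only
remain the asymptotic constants (`c₀(N) ∼ 1.5427√N`, `c_m(N) ∼ ρ_∞√(πN/m)`) of
[ForresterEtAl2003, §2.2.2] (catalogue entry `OneDimensionalHardCoreSqrt`).

## References

* [ForresterEtAl2003] P. J. Forrester, N. E. Frankel, T. M. Garoni, N. S. Witte, *Finite
  one-dimensional impenetrable Bose systems: occupation numbers*, Phys. Rev. A 67 (2003) 043607,
  arXiv:cond-mat/0211126: §2.1.1–2.1.2 (normalised ground state, `ρ_N`), §2.2.1 (`c_n(N)`,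
  `∑_n c_n(N) = N`), §2.2.2 (asymptotics, not typed).

## Design notes

No definition and no named fact is introduced (D-0026); every result is a `theorem` about the
objects of the statement file and of the Bands / Positivity companions. The Fourier step is
Mathlib's Parseval identity `hasSum_sq_fourierCoeffOn` for `L²(0, L]`, transported to our plane
waves `ez L m` by `fourier_neg_coe_smul`.
-/

noncomputable section

open MeasureTheory Filter Topology Finset Complex
open scoped BigOperators Real ComplexConjugate

namespace Literature.Barriers.AtomisticToContinuum.BoseGas

variable {n : ℕ} {L : ℝ}

/-! ### Parseval for the smeared Girardeau state -/

/-- The Fourier character of Mathlib's `AddCircle T` against our plane wave `e_m`: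
`fourier (-m) (y : AddCircle T) • c = c · e_{-m}(y)`. [folklore] -/
theorem fourier_neg_coe_smul (T : ℝ) (m : ℤ) (y : ℝ) (c : ℂ) :
    fourier (-m) (y : AddCircle T) • c = c * ez T (-m) y := by
  rw [fourier_coe_apply, smul_eq_mul, mul_comm]
  congr 1
  unfold ez
  congr 1
  push_cast
  ring

/-- **Parseval for `y ↦ ψ_{n+1}(X, y)` on `[0, L]`**: for every `X`,
`∑_{m ∈ ℤ} |∫₀ᴸ ψ_{n+1}(X, y) e_m(y) dy|² = L ∫₀ᴸ ψ_{n+1}(X, y)² dy` (Mathlib's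
`hasSum_sq_fourierCoeffOn`, the state being bounded and continuous). [folklore] -/
theorem hasSum_sq_norm_integral_girardeauState_ez (hL : 0 < L) (n : ℕ) (X : Fin n → ℝ) :
    HasSum (fun m : ℤ => ‖∫ y in Set.Icc 0 L,
        (girardeauState (n + 1) L (Fin.snoc X y) : ℂ) * ez L m y‖ ^ 2)
      (L * ∫ y in Set.Icc 0 L, girardeauState (n + 1) L (Fin.snoc X y) ^ 2) := by
  set f : ℝ → ℂ := fun y => (girardeauState (n + 1) L (Fin.snoc X y) : ℂ) with hf
  have hfc : Continuous f :=
    Complex.continuous_ofReal.comp ((continuous_girardeauState (n + 1) L).comp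
      (Continuous.finSnoc (A := fun _ : Fin (n + 1) => ℝ) continuous_const continuous_id))
  have hfm : MemLp f 2 (volume.restrict (Set.Ioc 0 L)) := by
    refine MemLp.of_bound hfc.aestronglyMeasurable
      ((Real.sqrt ((n + 1).factorial * L ^ (n + 1)))⁻¹ * 2 ^ ((n + 1) * (n + 1)))
      (Filter.Eventually.of_forall fun y => ?_)
    rw [hf, Complex.norm_real, Real.norm_eq_abs, abs_of_nonneg (girardeauState_nonneg _ _ _)]
    exact girardeauState_le_crude _ _ _
  have h := hasSum_sq_fourierCoeffOn hL hfm
  -- identify the Fourier coefficients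
  have hcoef : ∀ i : ℤ, ‖fourierCoeffOn hL f i‖ ^ 2 =
      (L ^ 2)⁻¹ * ‖∫ y in Set.Icc 0 L, f y * ez L (-i) y‖ ^ 2 := by
    intro i
    rw [fourierCoeffOn_eq_integral, intervalIntegral.integral_of_le hL.le,
      ← integral_Icc_eq_integral_Ioc]
    have hint : ∫ y in Set.Icc 0 L, fourier (-i) (y : AddCircle (L - 0)) • f y =
        ∫ y in Set.Icc 0 L, f y * ez L (-i) y := by
      refine integral_congr_ae (Filter.Eventually.of_forall fun y => ?_)
      simp only
      rw [fourier_neg_coe_smul, sub_zero]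
    rw [hint, norm_smul, mul_pow, sub_zero, one_div, norm_inv, Real.norm_eq_abs, abs_of_pos hL,
      inv_pow]
  -- identify the right-hand side
  have hrhs : (L - 0)⁻¹ • ∫ x in (0 : ℝ)..L, ‖f x‖ ^ 2 =
      L⁻¹ * ∫ y in Set.Icc 0 L, girardeauState (n + 1) L (Fin.snoc X y) ^ 2 := by
    rw [sub_zero, smul_eq_mul, intervalIntegral.integral_of_le hL.le,
      ← integral_Icc_eq_integral_Ioc]
    congr 1
    refine integral_congr_ae (Filter.Eventually.of_forall fun y => ?_)
    simp only [hf, Complex.norm_real, Real.norm_eq_abs, sq_abs]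
  rw [hrhs] at h
  simp_rw [hcoef] at h
  -- scale by `L²` and reindex `i ↦ -m`
  have h2 := h.mul_left (L ^ 2)
  have hL2 : L ^ 2 ≠ 0 := pow_ne_zero 2 hL.ne'
  simp_rw [← mul_assoc, mul_inv_cancel₀ hL2, one_mul] at h2
  rw [show L ^ 2 * L⁻¹ * ∫ y in Set.Icc 0 L, girardeauState (n + 1) L (Fin.snoc X y) ^ 2 =
      L * ∫ y in Set.Icc 0 L, girardeauState (n + 1) L (Fin.snoc X y) ^ 2 by
    rw [pow_two, mul_assoc L L, mul_inv_cancel₀ hL.ne', mul_one]] at h2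
  refine (Equiv.neg ℤ).hasSum_iff.mp ?_
  exact h2

/-! ### The normalisation `∫_{[0,L]^n} ∫₀ᴸ ψ_{n+1}(X, y)² dy dX = 1` -/

/-- `(X, y) ↦ ψ_{n+1}(X, y)²` is integrable on `[0,L]^n × [0,L]`. [folklore] -/
theorem integrable_girardeauState_snoc_sq (n : ℕ) (L : ℝ) :
    Integrable (Function.uncurry fun (X : Fin n → ℝ) (y : ℝ) =>
        girardeauState (n + 1) L (Fin.snoc X y) ^ 2)
      (((volume : Measure (Fin n → ℝ)).restrict
          (Set.pi Set.univ fun _ : Fin n => Set.Icc (0 : ℝ) L)).prod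
        (volume.restrict (Set.Icc (0 : ℝ) L))) := by
  haveI := isFiniteMeasure_restrict_box n L
  set B : ℝ := (Real.sqrt ((n + 1).factorial * L ^ (n + 1)))⁻¹ * 2 ^ ((n + 1) * (n + 1)) with hB
  refine Integrable.of_bound ((continuous_girardeauState_snoc n L).pow 2).aestronglyMeasurable
    (B ^ 2) (Filter.Eventually.of_forall ?_)
  rintro ⟨X, y⟩
  simp only [Function.uncurry_apply_pair, Real.norm_eq_abs, abs_pow,
    abs_of_nonneg (girardeauState_nonneg _ _ _)]
  exact pow_le_pow_left₀ (girardeauState_nonneg _ _ _) (girardeauState_le_crude _ _ _) 2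

/-- `∫_{[0,L]^n} ψ_{n+1}(X, a)² dX = 1/L` for `a ∈ [0, L]` (the diagonal of the one-body density
matrix, `ρ_N(a, a) = N/L`, `girardeauDensityMatrix_self`). [cite: ForresterEtAl2003, §2.1.2] -/
theorem integral_girardeauState_snoc_sq (hL : 0 < L) (n : ℕ) {a : ℝ} (ha : a ∈ Set.Icc 0 L) :
    ∫ X in Set.pi Set.univ (fun _ : Fin n => Set.Icc (0 : ℝ) L),
      girardeauState (n + 1) L (Fin.snoc X a) ^ 2 = L⁻¹ := by
  have h := girardeauDensityMatrix_self hL ha n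
  have hdef : girardeauDensityMatrix (n + 1) L a a = (n + 1 : ℝ) *
      ∫ X in Set.pi Set.univ (fun _ : Fin n => Set.Icc (0 : ℝ) L),
        girardeauState (n + 1) L (Fin.snoc X a) * girardeauState (n + 1) L (Fin.snoc X a) := rfl
  rw [hdef] at h
  have hn : (n + 1 : ℝ) ≠ 0 := by positivity
  simp_rw [← pow_two] at h
  field_simp at h
  have : ∫ X in Set.pi Set.univ (fun _ : Fin n => Set.Icc (0 : ℝ) L),
      girardeauState (n + 1) L (Fin.snoc X a) ^ 2 = 1 / L := by
    rw [eq_div_iff hL.ne']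
    linarith [h]
  rw [this, one_div]

/-- **Normalisation of the Girardeau state**, in the form used here:
`∫_{[0,L]^n} (L ∫₀ᴸ ψ_{n+1}(X, y)² dy) dX = L`. [cite: ForresterEtAl2003, §2.1.1] -/
theorem integral_integral_girardeauState_snoc_sq (hL : 0 < L) (n : ℕ) :
    ∫ X in Set.pi Set.univ (fun _ : Fin n => Set.Icc (0 : ℝ) L),
      L * ∫ y in Set.Icc 0 L, girardeauState (n + 1) L (Fin.snoc X y) ^ 2 = L := by
  set S : Set (Fin n → ℝ) := Set.pi Set.univ (fun _ : Fin n => Set.Icc (0 : ℝ) L) with hS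
  set μ : Measure (Fin n → ℝ) := volume.restrict S with hμ
  set ν : Measure ℝ := volume.restrict (Set.Icc (0 : ℝ) L) with hν
  haveI : IsFiniteMeasure μ := isFiniteMeasure_restrict_box n L
  have hI : Integrable (Function.uncurry fun (X : Fin n → ℝ) (y : ℝ) =>
      girardeauState (n + 1) L (Fin.snoc X y) ^ 2) (μ.prod ν) :=
    integrable_girardeauState_snoc_sq n L
  rw [integral_const_mul, integral_integral_swap hI]
  have hinner : ∀ y ∈ Set.Icc (0 : ℝ) L,
      ∫ X, girardeauState (n + 1) L (Fin.snoc X y) ^ 2 ∂μ = L⁻¹ := fun y hy =>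
    integral_girardeauState_snoc_sq hL n hy
  rw [hν, setIntegral_congr_fun measurableSet_Icc hinner, setIntegral_const, smul_eq_mul,
    Real.volume_real_Icc_of_le hL.le, sub_zero, mul_inv_cancel₀ hL.ne', mul_one]

/-! ### The momentum sum rule -/

/-- **Momentum sum rule (Parseval): `∑_{m ∈ ℤ} c_m(N) = N`.** For every `L > 0` and every `N`,
the plane-wave occupations of Girardeau's ground state form a summable family with sum `N`
(unconditional sum over `ℤ`): the trace of `γ_N` in the momentum basis. Proof: the Gram form
`c_m(N) = L⁻¹ N ∫_{[0,L]^{N-1}} |∫₀ᴸ ψ_N(X, y) e_m(y) dy|² dX` (`girardeauForm_succ_eq_gram`),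
Parseval on `[0, L]` for `y ↦ ψ_N(X, y)` at each `X`, monotone summation under the `X`-integral
(non-negative terms), and the normalisation `∫ψ_N² = 1` (from `ρ_N(x, x) = N/L`).
[cite: ForresterEtAl2003, §2.2.1] -/
theorem hasSum_momentumOccupation (hL : 0 < L) (N : ℕ) :
    HasSum (fun m : ℤ => momentumOccupation N L m) (N : ℝ) := by
  cases N with
  | zero =>
      have h0 : (fun m : ℤ => momentumOccupation 0 L m) = fun _ => 0 := by
        funext m
        simp [momentumOccupation, girardeauForm, girardeauDensityMatrix]
      rw [h0, Nat.cast_zero]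
      exact hasSum_zero
  | succ n =>
    set S : Set (Fin n → ℝ) := Set.pi Set.univ (fun _ : Fin n => Set.Icc (0 : ℝ) L) with hS
    set μ : Measure (Fin n → ℝ) := volume.restrict S with hμ
    set ν : Measure ℝ := volume.restrict (Set.Icc (0 : ℝ) L) with hν
    haveI : IsFiniteMeasure μ := isFiniteMeasure_restrict_box n L
    set ψ : (Fin n → ℝ) → ℝ → ℝ := fun X y => girardeauState (n + 1) L (Fin.snoc X y) with hψ
    set g : ℤ → (Fin n → ℝ) → ℝ := fun m X =>
      ‖∫ y in Set.Icc 0 L, (ψ X y : ℂ) * ez L m y‖ ^ 2 with hg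
    set G : (Fin n → ℝ) → ℝ := fun X => L * ∫ y in Set.Icc 0 L, ψ X y ^ 2 with hG
    set B : ℝ := (Real.sqrt ((n + 1).factorial * L ^ (n + 1)))⁻¹ * 2 ^ ((n + 1) * (n + 1)) with hB
    -- (1) the occupations through the Gram form
    have hc : ∀ m : ℤ, momentumOccupation (n + 1) L m = L⁻¹ * ((n + 1 : ℝ) * ∫ X, g m X ∂μ) := by
      intro m
      unfold momentumOccupation
      rw [girardeauForm_succ_eq_gram n L ((continuous_ez L m).integrableOn_Icc), Complex.ofReal_re]
    -- (2) Parseval at each `X`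
    have hpt : ∀ X, HasSum (fun m => g m X) (G X) := fun X =>
      hasSum_sq_norm_integral_girardeauState_ez hL n X
    have hg0 : ∀ m X, 0 ≤ g m X := fun m X => by positivity
    -- (3) integrability of the terms and of the sum
    have hgi : ∀ m : ℤ, Integrable (g m) μ := by
      intro m
      have hF : Integrable (fun p : (Fin n → ℝ) × ℝ => (ψ p.1 p.2 : ℂ) * ez L m p.2) (μ.prod ν) :=
        integrable_girardeauState_snoc_mul n L ((continuous_ez L m).integrableOn_Icc)
      refine Integrable.of_bound (hF.integral_prod_left.aestronglyMeasurable.norm.pow 2)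
        ((B * L) ^ 2) (Filter.Eventually.of_forall fun X => ?_)
      rw [Real.norm_eq_abs, abs_pow, abs_norm]
      refine pow_le_pow_left₀ (norm_nonneg _) ?_ 2
      have hb : ∀ y ∈ Set.Icc (0 : ℝ) L, ‖(ψ X y : ℂ) * ez L m y‖ ≤ B := fun y _ => by
        rw [norm_mul, norm_ez, mul_one, Complex.norm_real, Real.norm_eq_abs,
          abs_of_nonneg (girardeauState_nonneg _ _ _)]
        exact girardeauState_le_crude _ _ _
      calc ‖∫ y in Set.Icc 0 L, (ψ X y : ℂ) * ez L m y‖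
          ≤ B * volume.real (Set.Icc (0 : ℝ) L) :=
            norm_setIntegral_le_of_norm_le_const measure_Icc_lt_top hb
        _ = B * L := by rw [Real.volume_real_Icc_of_le hL.le, sub_zero]
    have hGi : Integrable G μ :=
      ((integrable_girardeauState_snoc_sq n L).integral_prod_left).const_mul L
    -- (4) bounded partial sums, summability
    have hsum_le : ∀ s : Finset ℤ, ∑ m ∈ s, ∫ X, g m X ∂μ ≤ ∫ X, G X ∂μ := by
      intro s
      rw [← integral_finsetSum s (fun m _ => hgi m)]
      exact integral_mono (integrable_finsetSum s fun m _ => hgi m) hGi fun X =>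
        sum_le_hasSum s (fun m _ => hg0 m X) (hpt X)
    have hsble : Summable fun m => ∫ X, g m X ∂μ :=
      summable_of_sum_le (fun m => integral_nonneg (hg0 m)) hsum_le
    -- (5) summation under the integral
    have hswap : HasSum (fun m => ∫ X, g m X ∂μ) (∫ X, G X ∂μ) := by
      have hnorm : (fun m => ∫ X, ‖g m X‖ ∂μ) = fun m => ∫ X, g m X ∂μ := by
        funext m
        refine integral_congr_ae (Filter.Eventually.of_forall fun X => ?_)
        simp only [Real.norm_eq_abs, abs_of_nonneg (hg0 m X)]
      have h1 := hasSum_integral_of_summable_integral_norm hgi (hnorm ▸ hsble)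
      have h2 : ∫ X, (∑' m, g m X) ∂μ = ∫ X, G X ∂μ :=
        integral_congr_ae (Filter.Eventually.of_forall fun X => (hpt X).tsum_eq)
      rwa [h2] at h1
    -- (6) the value of the integral and assembly
    have hGval : ∫ X, G X ∂μ = L := integral_integral_girardeauState_snoc_sq hL n
    rw [hGval] at hswap
    have h3 := (hswap.mul_left (n + 1 : ℝ)).mul_left L⁻¹
    rw [show L⁻¹ * ((n + 1 : ℝ) * L) = ((n + 1 : ℕ) : ℝ) by push_cast; field_simp] at h3
    exact h3.congr_fun fun m => hc m

/-- `∑_{m ∈ ℤ} c_m(N) = N` as a `tsum`. [cite: ForresterEtAl2003, §2.2.1] -/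
theorem tsum_momentumOccupation (hL : 0 < L) (N : ℕ) :
    ∑' m : ℤ, momentumOccupation N L m = N :=
  (hasSum_momentumOccupation hL N).tsum_eq

/-- The occupations are summable. [cite: ForresterEtAl2003, §2.2.1] -/
theorem summable_momentumOccupation (hL : 0 < L) (N : ℕ) :
    Summable fun m : ℤ => momentumOccupation N L m :=
  (hasSum_momentumOccupation hL N).summable

/-! ### Consequences for bands -/

/-- The band as a sum over the integer interval `[-M, M]`. [folklore] -/
theorem bandOccupation_eq_sum_Icc (N : ℕ) (L : ℝ) (M : ℕ) :
    bandOccupation N L M = ∑ m ∈ Finset.Icc (-(M : ℤ)) M, momentumOccupation N L m := by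
  unfold bandOccupation
  have hinj : Set.InjOn (fun k : ℕ => (k : ℤ) - M) (Finset.range (2 * M + 1) : Set ℕ) :=
    fun a _ b _ h => by simpa using h
  rw [← Finset.sum_image (f := fun m : ℤ => momentumOccupation N L m)
    (g := fun k : ℕ => (k : ℤ) - M) (s := Finset.range (2 * M + 1)) (fun a ha b hb h => hinj ha hb h)]
  congr 1
  ext z
  simp only [Finset.mem_image, Finset.mem_range, Finset.mem_Icc]
  constructor
  · rintro ⟨k, hk, rfl⟩
    omega
  · intro h
    exact ⟨(z + M).toNat, by omega, by omega⟩

/-- **Every band carries at most `N` particles**: `B_M(N) ≤ N` for all `M` (finite sub-sums of a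
non-negative family with sum `N`). [cite: ForresterEtAl2003, §2.2.1] -/
theorem bandOccupation_le (hL : 0 < L) (N M : ℕ) : bandOccupation N L M ≤ N := by
  rw [bandOccupation_eq_sum_Icc]
  exact sum_le_hasSum _ (fun m _ => momentumOccupation_nonneg hL N m) (hasSum_momentumOccupation hL N)

/-- **`B_M(N) → N` as `M → ∞`** (at fixed `N`): the symmetric partial sums of the momentum
distribution exhaust the particle number. [cite: ForresterEtAl2003, §2.2.1] -/
theorem tendsto_bandOccupation_atTop (hL : 0 < L) (N : ℕ) :
    Tendsto (fun M : ℕ => bandOccupation N L M) atTop (𝓝 (N : ℝ)) := by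
  have hu : Tendsto (fun M : ℕ => Finset.Icc (-(M : ℤ)) M) atTop atTop := by
    refine Filter.tendsto_atTop_finset_of_monotone (fun a b hab => ?_) fun z => ?_
    · exact Finset.Icc_subset_Icc (by omega) (by omega)
    · exact ⟨z.natAbs, by simp only [Finset.mem_Icc]; omega⟩
  have h := (hasSum_momentumOccupation hL N).comp hu
  refine h.congr fun M => ?_
  simp only [Function.comp_apply]
  exact (bandOccupation_eq_sum_Icc N L M).symm

end Literature.Barriers.AtomisticToContinuum.BoseGas
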